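import Summits.Ventures.PackingBounds.ThreePointCert.Check
import Literature.Geometry.DiscreteGeometry.KissingCertDefs
import Literature.Geometry.DiscreteGeometry.ThreePointBoundGeneral

/-!
# Soundness of the general-dimension three-point certificate checker

Framing: lottery ticket; floor = certified bounds/negative ranges. Venture `PackingBounds`
(cell `pub-packcert`), three-point SDP family.

Meaning of the kernel programs of `ThreePointCert.Check` and the soundness theorem
`card_le_of_cert3`: if a certificate `c : Cert3` with expansion data `P : CertPolys3` passes
`checkSide3`, `checkBound3`, `checkI3`, `checkII3`, and the expansions are validated (`PolysOK3`:
the `FI` expansion and the seven Gram expansions, each by `decide` on `FexpOKG`/`FchunkOKG` and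
`chunkOK`), then every finite set of unit vectors of `ℝⁿ` (`n = c.n ≥ 4`) with pairwise inner
products `≤ c.p/c.q` has at most `c.N` elements. The bound is Bachoc–Vallentin's Theorem 4.2 in
the general form `Literature.Geometry.DiscreteGeometry.BachocVallentin.card_le_of_threePoint`
(all `n ≥ 4`, all `s`), with the three-point positivity (pos S) of
`ThreePointKernelGeneral` — no named-fact hypothesis.

Contents: values of the Gegenbauer tables (`eval_gegTwoI`, `eval_QI`, by the three-term
recurrences `gegenbauerSum_rec` / `gegenbauerHom_rec`), of the reflected three-point part
(`eval_FPolyG = W · FvalG`) and two-point part (`eval_APolyG = W · AvalG`), positivity of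
`FvalG`/`AvalG` over a code (`tripleSum_FvalG_nonneg`, `pairSum_AvalG_nonneg`) and the multipliers;
the checks themselves are treated in `ThreePointCert.Soundness` (`FII3_of_check`, `AF3_of_check`,
`card_le_of_cert3`).

## References
* C. Bachoc, F. Vallentin, J. Amer. Math. Soc. 21 (2008), Theorem 4.2. [`BachocVallentin2007`]
-/

noncomputable section

open Finset
open scoped RealInnerProductSpace

namespace Summit.Ventures.PackingBounds.ThreePointCert

open Literature.Geometry.DiscreteGeometry Literature.Geometry.DiscreteGeometry.PolyCert
open Literature.Geometry.DiscreteGeometry.PolyCert.SPoly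
open Literature.Analysis.SpecialFunctions

/-! ### Values of the Gegenbauer tables -/

/-- `eval (gegTwoI n k) = 2^k k! · C_k^{(n-2)/2}(u)`. -/
theorem eval_gegTwoI (n k : ℕ) (u v t : ℝ) :
    eval (gegTwoI n k) u v t = 2 ^ k * (k.factorial : ℝ) * gegenbauerSum (((n : ℝ) - 2) / 2) k u := by
  induction k using Nat.twoStepInduction with
  | zero => simp [gegTwoI]
  | one =>
    rw [gegTwoI, eval_smul, eval_U, gegenbauerSum_one]
    push_cast; ring
  | more k ih0 ih1 =>
    rw [gegTwoI, eval_normalize, eval_append, eval_smul, eval_mulN, eval_smul, ih0, ih1, eval_U]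
    have h := gegenbauerSum_rec (((n : ℝ) - 2) / 2) k u
    have hf1 : ((k + 1).factorial : ℝ) = ((k : ℝ) + 1) * k.factorial := by
      rw [Nat.factorial_succ]; push_cast; ring
    have hf2 : ((k + 2).factorial : ℝ) = ((k : ℝ) + 2) * (((k : ℝ) + 1) * k.factorial) := by
      rw [Nat.factorial_succ, Nat.factorial_succ]; push_cast; ring
    rw [hf1, hf2]
    push_cast
    linear_combination (-(2 : ℝ) ^ (k + 2) * (((k : ℝ) + 1) * k.factorial)) * h

/-- `eval sigP = 2(t - uv)`. -/
@[simp] theorem eval_sigP (u v t : ℝ) : eval sigP u v t = 2 * (t - u * v) := by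
  simp [sigP, eval, Mono.eval]; ring

/-- `eval piP = (1-u²)(1-v²)`. -/
@[simp] theorem eval_piP (u v t : ℝ) : eval piP u v t = (1 - u ^ 2) * (1 - v ^ 2) := by
  simp [piP, eval, Mono.eval]; ring

/-- `eval (QI n k) = 2^k k! · Q n k (u,v,t)`. -/
theorem eval_QI (n k : ℕ) (u v t : ℝ) :
    eval (QI n k) u v t = 2 ^ k * (k.factorial : ℝ) * BachocVallentin.Q n k u v t := by
  induction k using Nat.twoStepInduction with
  | zero => simp [QI, BachocVallentin.Q_zero]
  | one =>
    rw [QI, eval_smul, eval_sigP, BachocVallentin.Q, gegenbauerHom_one, smul_eq_mul]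
    push_cast; ring
  | more k ih0 ih1 =>
    rw [QI, eval_normalize, eval_append, eval_smul, eval_mulN, eval_smul, eval_mulN, ih0, ih1,
      eval_sigP, eval_piP]
    have h := gegenbauerHom_rec (((n : ℝ) - 3) / 2) (2 * (t - u * v)) ((1 - u ^ 2) * (1 - v ^ 2)) k
    simp only [smul_eq_mul] at h
    rw [BachocVallentin.Q, BachocVallentin.Q, BachocVallentin.Q] at *
    have hf1 : ((k + 1).factorial : ℝ) = ((k : ℝ) + 1) * k.factorial := by
      rw [Nat.factorial_succ]; push_cast; ring
    have hf2 : ((k + 2).factorial : ℝ) = ((k : ℝ) + 2) * (((k : ℝ) + 1) * k.factorial) := by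
      rw [Nat.factorial_succ, Nat.factorial_succ]; push_cast; ring
    rw [hf1, hf2]
    push_cast
    linear_combination (-(2 : ℝ) ^ (k + 2) * (((k : ℝ) + 1) * k.factorial)) * h

/-- `M_k · 2^k k! = W` for `k ≤ d`. -/
theorem Mfac_mul (d k : ℕ) (hk : k ≤ d) : Mfac d k * (2 ^ k * k.factorial) = Wfac d := by
  unfold Mfac Wfac
  have h1 : 2 ^ (d - k) * 2 ^ k = 2 ^ d := by rw [← pow_add, Nat.sub_add_cancel hk]
  have h2 : Nat.descFactorial d (d - k) * k.factorial = d.factorial := by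
    have := Nat.factorial_mul_descFactorial (Nat.sub_le d k)
    rw [Nat.sub_sub_self hk] at this
    rw [mul_comm]; exact this
  calc 2 ^ (d - k) * Nat.descFactorial d (d - k) * (2 ^ k * k.factorial)
      = (2 ^ (d - k) * 2 ^ k) * (Nat.descFactorial d (d - k) * k.factorial) := by ring
    _ = 2 ^ d * d.factorial := by rw [h1, h2]

/-- `W > 0`. -/
theorem Wfac_pos (d : ℕ) : 0 < Wfac d := by
  unfold Wfac; positivity

/-! ### The three-point part -/

/-- The `Y`-form in dimension `n`: `φ(u) φ(v) Q n k (u,v,t)`. -/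
def YG (n k : ℕ) (φ : ℝ → ℝ) (u v t : ℝ) : ℝ := φ u * φ v * BachocVallentin.Q n k u v t

/-- `F` in units of `1/D²`: `Σ_blocks Σ_w sym6 (YG n k φ_w)`. -/
def FvalG (n : ℕ) (bs : List FBlk) (u v t : ℝ) : ℝ :=
  (bs.map fun b => (b.ws.map fun w => sym6 (YG n b.k (phiW w)) u v t).sum).sum

/-- `tripleSum` (general `n`) of a list-indexed sum. -/
theorem tripleSum_listSumG {n : ℕ} {α : Type*} (C : Finset (EuclideanSpace ℝ (Fin n))) (l : List α)
    (f : α → ℝ → ℝ → ℝ → ℝ) :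
    BachocVallentin.tripleSum C (fun u v t => (l.map fun a => f a u v t).sum) =
      (l.map fun a => BachocVallentin.tripleSum C (f a)).sum := by
  induction l with
  | nil => simp [BachocVallentin.tripleSum]
  | cons a l ih =>
    simp only [List.map_cons, List.sum_cons]
    rw [← ih]
    simp only [BachocVallentin.tripleSum, Finset.sum_add_distrib]

/-- **Positivity of the three-point part** over any finite set of unit vectors of `ℝⁿ`, `n ≥ 4`
(Bachoc–Vallentin (pos S), from `ThreePointKernelGeneral`). -/
theorem tripleSum_FvalG_nonneg {n : ℕ} (hn : 4 ≤ n) (bs : List FBlk)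
    (C : Finset (EuclideanSpace ℝ (Fin n))) (hC : ∀ x ∈ C, ‖x‖ = 1) :
    0 ≤ BachocVallentin.tripleSum C (FvalG n bs) := by
  unfold FvalG
  rw [tripleSum_listSumG]
  refine List.sum_nonneg ?_
  intro x hx
  rw [List.mem_map] at hx
  obtain ⟨b, _, rfl⟩ := hx
  rw [tripleSum_listSumG]
  refine List.sum_nonneg ?_
  intro y hy
  rw [List.mem_map] at hy
  obtain ⟨w, _, rfl⟩ := hy
  exact BachocVallentin.tripleSum_sym6_weight_nonneg hn b.k (phiW w) C hC

/-- `FvalG` is symmetric in its first two arguments. -/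
theorem FvalG_swap12 (n : ℕ) (bs : List FBlk) (u v t : ℝ) : FvalG n bs u v t = FvalG n bs v u t := by
  unfold FvalG
  congr 1; refine List.map_congr_left fun b _ => ?_
  congr 1; refine List.map_congr_left fun w _ => ?_
  exact sym6_swap12 _ u v t

/-- `FvalG` is symmetric in its last two arguments. -/
theorem FvalG_swap23 (n : ℕ) (bs : List FBlk) (u v t : ℝ) : FvalG n bs u v t = FvalG n bs u t v := by
  unfold FvalG
  congr 1; refine List.map_congr_left fun b _ => ?_
  congr 1; refine List.map_congr_left fun w _ => ?_
  exact sym6_swap23 _ u v t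

/-- Expansion of one weight vector: `sym6 (YG n k φ_w) = Σ_{a,b} w_a w_b sym6 (u^a v^b Q n k)`. -/
theorem sym6_YG_phiW (n k : ℕ) (w : List ℤ) (u v t : ℝ) :
    sym6 (YG n k (phiW w)) u v t = ∑ a ∈ Finset.range w.length, ∑ b ∈ Finset.range w.length,
      ((w.getD a 0 * w.getD b 0 : ℤ) : ℝ) *
        sym6 (fun u v t => u ^ a * v ^ b * BachocVallentin.Q n k u v t) u v t := by
  have key : ∀ x y r : ℝ, phiW w x * phiW w y * r =
      ∑ a ∈ Finset.range w.length, ∑ b ∈ Finset.range w.length,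
        ((w.getD a 0 * w.getD b 0 : ℤ) : ℝ) * (x ^ a * y ^ b * r) := by
    intro x y r
    unfold phiW
    rw [Finset.sum_mul_sum, Finset.sum_mul]
    refine Finset.sum_congr rfl fun a _ => ?_
    rw [Finset.sum_mul]
    refine Finset.sum_congr rfl fun b _ => ?_
    push_cast; ring
  simp only [sym6, YG, key, ← Finset.sum_add_distrib]
  refine Finset.sum_congr rfl fun a _ => Finset.sum_congr rfl fun b _ => ?_
  ring

/-- `eval (baseTabG n k a b) = 2^k k! · u^a v^b Q n k`. -/
theorem eval_baseTabG (n k a b : ℕ) (u v t : ℝ) :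
    eval (baseTabG n k a b) u v t =
      2 ^ k * (k.factorial : ℝ) * (u ^ a * v ^ b * BachocVallentin.Q n k u v t) := by
  rw [baseTabG, eval_normalize, eval_mulN, eval_QI]
  simp [eval, Mono.eval]; ring

/-- `eval (symTabG n k a b) = 2^k k! · sym6 (u^a v^b Q n k)`. -/
theorem eval_symTabG (n k a b : ℕ) (u v t : ℝ) :
    eval (symTabG n k a b) u v t = 2 ^ k * (k.factorial : ℝ) *
      sym6 (fun u v t => u ^ a * v ^ b * BachocVallentin.Q n k u v t) u v t := by
  simp only [symTabG, eval_normalize, eval_append, eval_permBAC, eval_permACB, eval_permCBA,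
    eval_permCAB, eval_permBCA, eval_baseTabG, sym6]
  ring

/-- `eval (FwPolyG n k w) = 2^k k! · sym6 (YG n k φ_w)`. -/
theorem eval_FwPolyG (n k : ℕ) (w : List ℤ) (u v t : ℝ) :
    eval (FwPolyG n k w) u v t = 2 ^ k * (k.factorial : ℝ) * sym6 (YG n k (phiW w)) u v t := by
  rw [FwPolyG, eval_mergeAll, List.map_map, sym6_YG_phiW, Finset.mul_sum, ← list_sum_map_range]
  refine congrArg List.sum (List.map_congr_left fun a _ => ?_)
  simp only [Function.comp_apply]
  rw [eval_mergeAll, List.map_map, Finset.mul_sum, ← list_sum_map_range]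
  refine congrArg List.sum (List.map_congr_left fun b' _ => ?_)
  simp only [Function.comp_apply]
  rw [eval_smul, eval_symTabG]; ring

/-- `eval` of one block (`k ≤ d`): `W · Σ_w sym6 (YG n k φ_w)`. -/
theorem eval_FbPolyG (n d : ℕ) (b : FBlk) (hk : b.k ≤ d) (u v t : ℝ) :
    eval (FbPolyG n d b) u v t =
      (Wfac d : ℝ) * (b.ws.map fun w => sym6 (YG n b.k (phiW w)) u v t).sum := by
  have hW : (Mfac d b.k : ℝ) * (2 ^ b.k * (b.k.factorial : ℝ)) = (Wfac d : ℝ) := by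
    exact_mod_cast Mfac_mul d b.k hk
  rw [FbPolyG, eval_smul, eval_mergeAll, List.map_map]
  have e : (b.ws.map ((fun p => eval p u v t) ∘ FwPolyG n b.k)).sum
      = 2 ^ b.k * (b.k.factorial : ℝ) * (b.ws.map fun w => sym6 (YG n b.k (phiW w)) u v t).sum := by
    rw [← List.sum_map_mul_left]
    exact congrArg List.sum (List.map_congr_left fun w _ => by
      simp only [Function.comp_apply, eval_FwPolyG])
  rw [e, ← mul_assoc]
  push_cast
  rw [hW]

/-- `eval (FPolyG n d bs) = W · FvalG n bs` when all blocks have degree `≤ d`. -/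
theorem eval_FPolyG (n d : ℕ) (bs : List FBlk) (hk : ∀ b ∈ bs, b.k ≤ d) (u v t : ℝ) :
    eval (FPolyG n d bs) u v t = (Wfac d : ℝ) * FvalG n bs u v t := by
  rw [FPolyG, eval_mergeAll, List.map_map, FvalG, ← List.sum_map_mul_left]
  exact congrArg List.sum (List.map_congr_left fun b hb => by
    simp only [Function.comp_apply]; rw [eval_FbPolyG n d b (hk b hb)])

/-! ### The two-point part -/

/-- `A` in units of `1/D²`: `Σ_{k < |A|} A_k C_k^{(n-2)/2}(u)`. -/
def AvalG (n : ℕ) (A : List ℕ) (u : ℝ) : ℝ :=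
  ∑ k ∈ Finset.range A.length, (A.getD k 0 : ℝ) * gegenbauerSum (((n : ℝ) - 2) / 2) k u

/-- `eval (APolyG n d A) = W · AvalG n A u` when `|A| ≤ d + 1`. -/
theorem eval_APolyG (n d : ℕ) (A : List ℕ) (hA : A.length ≤ d + 1) (u v t : ℝ) :
    eval (APolyG n d A) u v t = (Wfac d : ℝ) * AvalG n A u := by
  unfold APolyG AvalG
  rw [eval_mergeAll, List.map_map, list_sum_map_range, Finset.mul_sum]
  refine Finset.sum_congr rfl fun k hk => ?_
  rw [Finset.mem_range] at hk
  have hkd : k ≤ d := by omega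
  have hW : (Mfac d k : ℝ) * (2 ^ k * (k.factorial : ℝ)) = (Wfac d : ℝ) := by
    exact_mod_cast Mfac_mul d k hkd
  simp only [Function.comp_apply, eval_smul, eval_gegTwoI]
  push_cast
  rw [← hW]; ring

/-- **Positivity of the two-point part** over any finite set of unit vectors of `ℝⁿ`, `n ≥ 3`. -/
theorem pairSum_AvalG_nonneg {n : ℕ} (hn : 3 ≤ n) (A : List ℕ)
    (C : Finset (EuclideanSpace ℝ (Fin n))) (hC : ∀ x ∈ C, ‖x‖ = 1) :
    0 ≤ BachocVallentin.pairSum C (AvalG n A) := by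
  unfold AvalG
  have hswap : BachocVallentin.pairSum C (fun u => ∑ k ∈ Finset.range A.length,
      (A.getD k 0 : ℝ) * gegenbauerSum (((n : ℝ) - 2) / 2) k u)
      = ∑ k ∈ Finset.range A.length, (A.getD k 0 : ℝ) *
          BachocVallentin.pairSum C (fun u => gegenbauerSum (((n : ℝ) - 2) / 2) k u) := by
    simp only [BachocVallentin.pairSum, Finset.mul_sum]
    have h1 : ∀ x ∈ C, (∑ y ∈ C, ∑ k ∈ Finset.range A.length,
        (A.getD k 0 : ℝ) * gegenbauerSum (((n : ℝ) - 2) / 2) k (inner ℝ x y)) =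
        ∑ k ∈ Finset.range A.length, ∑ y ∈ C,
          (A.getD k 0 : ℝ) * gegenbauerSum (((n : ℝ) - 2) / 2) k (inner ℝ x y) :=
      fun x _ => Finset.sum_comm
    rw [Finset.sum_congr rfl h1, Finset.sum_comm]
  rw [hswap]
  exact Finset.sum_nonneg fun k _ => mul_nonneg (by positivity)
    (BachocVallentin.pairSum_gegenbauer_nonneg hn k C hC)

/-! ### Multipliers -/

/-- `eval (gqU p q) = (u+1)(p - q u)`. -/
@[simp] theorem eval_gqU (p : ℤ) (q : ℕ) (u v t : ℝ) :
    eval (gqU p q) u v t = (u + 1) * ((p : ℝ) - q * u) := by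
  simp [gqU, eval, Mono.eval]; ring

/-- `(u+1)(p - qu) ≥ 0` for `-1 ≤ u` and `q u ≤ p`. -/
theorem gq_nonneg (p : ℤ) (q : ℕ) (u : ℝ) (hu : -1 ≤ u) (hu' : (q : ℝ) * u ≤ p) :
    0 ≤ (u + 1) * ((p : ℝ) - q * u) := mul_nonneg (by linarith) (by linarith)

/-- `eval (m1P p q) = g(u) + g(v) + g(t)` with `g(x) = (x+1)(p - qx)`. -/
@[simp] theorem eval_m1P (p : ℤ) (q : ℕ) (u v t : ℝ) :
    eval (m1P p q) u v t = (u + 1) * ((p : ℝ) - q * u) + (v + 1) * ((p : ℝ) - q * v)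
      + (t + 1) * ((p : ℝ) - q * t) := by
  simp [m1P, eval_permBAC, eval_permCBA]; ring

/-- `eval (m2P p q) = g(u)g(v) + g(u)g(t) + g(v)g(t)`. -/
@[simp] theorem eval_m2P (p : ℤ) (q : ℕ) (u v t : ℝ) :
    eval (m2P p q) u v t = (u + 1) * ((p : ℝ) - q * u) * ((v + 1) * ((p : ℝ) - q * v))
      + (u + 1) * ((p : ℝ) - q * u) * ((t + 1) * ((p : ℝ) - q * t))
      + (v + 1) * ((p : ℝ) - q * v) * ((t + 1) * ((p : ℝ) - q * t)) := by
  simp [m2P, eval_permBAC, eval_permCBA]; ring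

/-- `eval (m3P p q) = g(u) g(v) g(t)`. -/
@[simp] theorem eval_m3P (p : ℤ) (q : ℕ) (u v t : ℝ) :
    eval (m3P p q) u v t =
      (u + 1) * ((p : ℝ) - q * u) * ((v + 1) * ((p : ℝ) - q * v) * ((t + 1) * ((p : ℝ) - q * t))) := by
  simp [m3P, eval_permBAC, eval_permCBA]

end Summit.Ventures.PackingBounds.ThreePointCert

end
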